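/-
Copyright (c) 2026 the pub-hodgecm-mathlib formalisation cell (harness21).  Prover seat hodgecm-mathlib-F0P2-p07 (g2): Track B «K2-LIT»,
hLiu418 = stmt-HodgeConjecture-24832; (σ-A) road desk K2Liu-p25 (g3) WORD #18 «(W-w₂)@POINT» (LEAD F0P6-plan (g15) BATCH #253 (b)); consumer
K2Liu-p08 (g6) (an-3) `hcone_of_stages` step (5) («PROVIDED `vec_{g′} = (𝓕_{X₁} ⊠ 1) Θ_x`»).
-/
import Summits.HodgeConjecture.HodgeConjecture.Theorems.K2LiuLocalSWMiddleCellFunctional    -- ★ F6a+b: see-saw `toRep_localSplitting_blkLoc_boxSB`, block letters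
import Literature.RepresentationTheory.HeisenbergGroup.MetaplecticBoxHom                     -- ★ `boxEquivSB_mul`
import Summits.HodgeConjecture.HodgeConjecture.Theorems.K2LiuBadPlaceWhittakerShells          -- ★ `nElem_conj_eq` (`n(A t D⁻¹) = q n(t) q⁻¹` for `q ∈ P_Δ`) (ED. 2)
import HarnessLib

/-!
# Crux `HLiu418`, #42S block D row D-2, (σ-A) brick (W-w₂)@POINT: THE MIDDLE WEYL ELEMENT ACTS IN THE `j̃(p₁,p₂)`-MODEL AS THE PARTIAL FOURIER OPERATOR —
# `op(j̃) ∘ ω(s_T(blkLoc w_Δ^{T₁})) = γ • ((𝓕_{X₁} ∘ leviOpPi B₁) ⊠ 1) ∘ op(j̃)` on all of `𝒮(L⁺_v^{(n₁+n₂)+(n₁+n₂)})`, ONE unit `γ`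

Cell `hodgecm-mathlib`, crux item hLiu418 = `stmt-HodgeConjecture-24832`; squad K2 ∕ K2Liu; prover F0P2-p07 (g2).  THEOREMS ONLY (no `def`, no instance,
no notation, no named-fact hypothesis, no `sorry`); lane `--supports stmt-HodgeConjecture-24832 --as helper` (count-neutral helper).

WHY.  The (σ-A) chain for `N₂val(x)` (K2Liu-p08 (g6) (an-3), 2026-09-05T01:59:38Z) reads the local Siegel–Weil section's y-stage word ★ p864240 ∕ ★ (M2a-C2a)
`F_Φ(w₁ · m · n(t) · g) = c · ∫_{X₁} (unipOpPi c_{t′} vec)(x₁ ⊔ 0) dx₁`, `vec = op(j̃(p₁,p₂)) (frameOp_{PD}⁻¹ (ω(s′(tensorEmbLoc (m · g))) Φ))`, and after the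
ζ-stage Levi words (★ p864336) it needs that vector AT A GENERAL POINT `ζs ⊔ s`, i.e. the OPERATOR by which the middle Weyl element `w₁` acts in the
`j̃(p₁,p₂)`-model — not only its value at `0` (★ F6a: `ev₀ ∘ ω(m₀) ∘ ω(s w₁) = c · Haar_{X₁} ⊗ δ₀`).  NO new implementer theory is needed: ★ F6a's own proof
contains the operator identity ON PURE TENSORS — see-saw ★ `toRep_localSplitting_blkLoc_boxSB` (`ω(s_T(blkLoc h))(Φ₁ ⊠ Φ₂) = ω_{T₁}(h)Φ₁ ⊠ Φ₂`), the first
block's Weyl word through the Cayley-type `p₁` (★ F4a `exists_localOmega_weylDelta_apply_eq_smul`: `ω_{T₁}(w_Δ)Φ₁ = γ • op(p₁)⁻¹ (𝓕 (leviOpPi B₁ (op(p₁) Φ₁)))`)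
and `ω(j̃(p₁,p₂))(X ⊠ Y) = op(p₁)X ⊠ op(p₂)Y` (★ `toRep_boxLoc_boxSB`) — and pure tensors span (★ `linearMap_ext_boxSB`).  The block-2 implementer `p₂` enters
ONLY through `op(j̃)` (a bare mover suffices; no `(π p₂)⁻¹` is ever needed).
* §1 **`exists_toOp_boxLoc_localSplitting_blkLoc_weylDelta_eq_smul_boxEquivSB`** — the operator identity of the title (block datum `T = T₁ ⊕ᶠ T₂`,
  `T₁ = diagonal t₁`, `0 < n₁`, every finite place; `γ : ℂˣ`).
* §2 (ED. 2) **`exists_toOp_boxLoc_localSplitting_flip_siegel_nElem_mul_eq_smul_boxEquivSB`** — THE y-STAGE VECTOR WORD: for `p₁`, `p₂` over movers, a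
  Siegel element `q ∈ P_Δ` (`blkC (matA q) = 0`), every skew `t`, every `g` and `Ψ`:
  `op(j̃) (ω(s_T(w₁ · q · n(t) · g)) Ψ) = γ • ((𝓕 ∘ leviOpPi B₁) ⊠ 1) (unipOpPi c_{A t D⁻¹} (op(j̃) (ω(s_T(q · g)) Ψ)))` — §1 ⊕ ★ F4a's EXACT unipotent word
  `implementer_localOmega_nElem_apply` through `(π(j̃), op(j̃))` ⊕ ★ `nElem_conj_eq`; this is ★ p864240 ∕ (M2a-C2a)'s integrand as a VECTOR (before `∫_{X₁} (·)(x₁ ⊔ 0)`),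
  so the (σ-A) ζ-stage may read it at ANY point `q₁ ⊔ q₂` (★ [A2] `coe_boxEquivSB_fourierOpPi_refl_apply_glue`).
HONEST LABEL.  Count-neutral helper: `HC_CM` is proved only modulo the 7 printed citations (2 remaining named inputs: hLiu418 = `stmt-HodgeConjecture-24832`,
h413 = `stmt-HodgeConjecture-24833`) until rung 0 closes; `hcone`∕`hZ` stay BY VALUE (R2) per M-160f until (an-1)–(an-3) ★.

## References
* [Kudla1984] S. S. Kudla, *Seesaw dual reductive pairs* (1984), §1.   * [Kudla1994] S. S. Kudla, Israel J. Math. 87 (1994), §3 Thm. 3.1.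
* [MoeglinVignerasWaldspurger1987] C. Mœglin, M.-F. Vignéras, J.-L. Waldspurger, LNM 1291 (1987), Chap. 2 II.1 Rem. (6), II.6.
* [Weil1964] A. Weil, Acta Math. 111 (1964), n° 13 (16), p. 160 (the Weyl element acts as the Fourier transform).   * [Rangarao1993] R. Ranga Rao, Pacific J. Math. 157 (1993), Lemma 3.2.
* [WeilBNT1967] A. Weil, *Basic Number Theory* (1967), Chap. VII §2 Prop. 2 (pure tensors span `𝒮`).
-/

set_option autoImplicit false
set_option linter.dupNamespace false -- the mandated namespace repeats `HodgeConjecture.HodgeConjecture`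

noncomputable section

open scoped Matrix
open NumberField IsDedekindDomain MeasureTheory MeasureTheory.Measure Matrix
open Literature.RepresentationTheory.HeisenbergGroup Literature.RepresentationTheory.HeisenbergGroup.SymplecticMatrix
open Literature.NumberTheory.Automorphic Literature.NumberTheory.Automorphic.UnitaryGroup Literature.NumberTheory.Weil1964
open Literature.NumberTheory.GaloisRepresentations Literature.NumberTheory.GaloisRepresentations.IsNonarchimedeanLocalField
open Literature.RepresentationTheory.HarrisKudlaSweet1996
open Literature.NumberTheory.GelbartRogawski1991.UnitaryDualPair
open Literature.NumberTheory.GelbartRogawski1991.UnitaryDualPair.LocalSplitting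
open Literature.NumberTheory.GelbartRogawski1991.AdaptedBlocks
open Literature.NumberTheory.GelbartRogawski1991.UnitaryDualPair.LocalSplitting.DoubledBlock
open Summit.HodgeConjecture.HodgeConjecture.Cruxes.HLiu418.K2LiuLocalSWSectionDefs
open Summit.HodgeConjecture.HodgeConjecture.Cruxes.HLiu418.K2LiuLocalSWBigCellWords
open Summit.HodgeConjecture.HodgeConjecture.Cruxes.HLiu418.K2LiuLocalSWMiddleCellFunctional
open Summit.HodgeConjecture.HodgeConjecture.Cruxes.HLiu418.K2LiuBadPlaceWhittakerShells (nElem_conj_eq)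

namespace Summit.HodgeConjecture.HodgeConjecture.Cruxes.HLiu418.K2LiuLocalSWCornerVectorAtPoint

variable (L : Type) [Field L] [NumberField L] [IsCMField L] (v : HeightOneSpectrum (𝓞 (maximalRealSubfield L)))
  [MeasurableSpace (v.adicCompletion (maximalRealSubfield L))] [BorelSpace (v.adicCompletion (maximalRealSubfield L))]
  (μ : Measure (v.adicCompletion (maximalRealSubfield L))) [μ.IsAddHaarMeasure]
  (n₁ n₂ : ℕ) {T₁ : Matrix (Fin n₁) (Fin n₁) (maximalRealSubfield L)} {T₂ : Matrix (Fin n₂) (Fin n₂) (maximalRealSubfield L)}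
  (hT₁ : T₁.IsSymm) (hT₂ : T₂.IsSymm) (hT₁d : IsUnit T₁.det) (hT₂d : IsUnit T₂.det)
  (χ : HeckeCharacter L) (hχ : IsSplittingChar L 1 χ)

/-! ## §1 The middle Weyl element in the `j̃(p₁, p₂)`-model is the partial Fourier operator of the first block -/

include hT₁d in
set_option maxHeartbeats 16000000 in -- MEASURED 2026-09-05: 4 000 000 ∕ 8 000 000 ✗ (`whnf`: each rewrite retypes the doubled CM telescope of the see-saw, ≈ 0.8M a step), 16 000 000 ✓ (130 s)
/-- **the middle Weyl element through `j̃(p₁, p₂)` ON PURE TENSORS**: `ω(j̃(p₁,p₂) · s_T(blkLoc w_Δ^{T₁}))(Φ₁ ⊠ Φ₂) = γ • (𝓕 (leviOpPi B₁ (op(p₁) Φ₁))) ⊠ op(p₂) Φ₂`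
for ONE unit `γ` (all `Φ₁ Φ₂`) — ★ F6a's see-saw `toRep_localSplitting_blkLoc_boxSB`, the first block's Weyl word ★ `exists_localOmega_weylDelta_apply_eq_smul` through
the Cayley-type `p₁` (`hW₁`), and `ω(j̃)(X ⊠ Y) = op(p₁)X ⊠ op(p₂)Y` (★ `toRep_boxLoc_boxSB`); this is ★ F6a's proof step `hop`, exported BEFORE evaluation at `0`.
[cite: Kudla1984, §1] [cite: Kudla1994, §3 Thm. 3.1] [cite: Weil1964, n° 13 (16), p. 160] [cite: MoeglinVignerasWaldspurger1987, Chap. 2 II.1 Rem. (6), II.6] -/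
theorem exists_toRep_boxLoc_mul_localSplitting_blkLoc_weylDelta_boxSB (hn₁ : 0 < n₁) (t₁ : Fin n₁ → maximalRealSubfield L)
    (hT₁t : T₁ = Matrix.diagonal t₁)
    (hTv₁ : IsUnit (localGram (maximalRealSubfield L) (n₁ + n₁) (gramD (maximalRealSubfield L) n₁ T₁) v).det)
    (p₁ : LocalMp (maximalRealSubfield L) (n₁ + n₁) (gramD (maximalRealSubfield L) n₁ T₁) v)
    (B₁ : GL (Fin (n₁ + n₁)) (v.adicCompletion (maximalRealSubfield L)))
    (hW₁ : MpPsi.proj _ p₁ * iotaD (maximalRealSubfield L) L (IsCMField.complexConj L) (complexConj_imagUnit L) (imagUnit_ne_zero L)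
        (imagUnit_mul_self L) v n₁ hT₁ rfl (weylDelta (maximalRealSubfield L) L (IsCMField.complexConj L) v n₁ (T₀ := T₁) rfl) * (MpPsi.proj _ p₁)⁻¹ =
      (transportSp (localGram (maximalRealSubfield L) (n₁ + n₁) (gramD (maximalRealSubfield L) n₁ T₁) v) hTv₁ (SymplecticGroup.symJ _ _))⁻¹ *
        transportSp (localGram (maximalRealSubfield L) (n₁ + n₁) (gramD (maximalRealSubfield L) n₁ T₁) v) hTv₁ (levi B₁))
    {m : ℤ} (hm : (adeleAddCharAt (maximalRealSubfield L) v).HasConductorExp m)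
    (p₂ : LocalMp (maximalRealSubfield L) (n₂ + n₂) (gramD (maximalRealSubfield L) n₂ T₂) v) :
    ∃ γ : ℂˣ, ∀ (Φ₁ : SchwartzBruhat (Fin (n₁ + n₁) → v.adicCompletion (maximalRealSubfield L)))
      (Φ₂ : SchwartzBruhat (Fin (n₂ + n₂) → v.adicCompletion (maximalRealSubfield L))),
      MpPsi.toRep (localSchrodinger (maximalRealSubfield L) ((n₁ + n₂) + (n₁ + n₂))
          (gramD (maximalRealSubfield L) (n₁ + n₂) (UnitaryGroup.finSum n₁ n₂ T₁ T₂)) v)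
          (boxLoc (maximalRealSubfield L) v n₁ n₂ (T₁ := T₁) (T₂ := T₂) (p₁, p₂) *
            (localSplittingDatumCM L v μ (n₁ + n₂) (UnitaryGroup.isSymm_finSum hT₁ hT₂) (isUnit_det_finSum L n₁ n₂ hT₁d hT₂d) rfl χ hχ).localSplitting
              (blkLoc (maximalRealSubfield L) L (IsCMField.complexConj L) v n₁ n₂ (T₁ := T₁) (T₂ := T₂) rfl rfl
                (weylDelta (maximalRealSubfield L) L (IsCMField.complexConj L) v n₁ (T₀ := T₁) rfl)))
          (boxSB (v.adicCompletion (maximalRealSubfield L)) (blkIdx n₁ n₂) Φ₁ Φ₂) =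
        (γ : ℂ) • boxSB (v.adicCompletion (maximalRealSubfield L)) (blkIdx n₁ n₂)
          (fourierOpPi μ (isContinuousNontrivial_adeleAddCharAt (maximalRealSubfield L) v) hm (leviOpPi (glEquiv B₁) (MpPsi.toOp _ p₁ Φ₁)))
          (MpPsi.toOp _ p₂ Φ₂) := by
  have hψ := isContinuousNontrivial_adeleAddCharAt (maximalRealSubfield L) v
  have hp₁rep : ∀ X, MpPsi.toRep (localSchrodinger (maximalRealSubfield L) (n₁ + n₁) (gramD (maximalRealSubfield L) n₁ T₁) v) p₁ X =
      MpPsi.toOp _ p₁ X := fun _ => rfl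
  have hp₂rep : ∀ X, MpPsi.toRep (localSchrodinger (maximalRealSubfield L) (n₂ + n₂) (gramD (maximalRealSubfield L) n₂ T₂) v) p₂ X =
      MpPsi.toOp _ p₂ X := fun _ => rfl
  -- the Weyl word of the first block through `(π(p₁), op(p₁))`
  obtain ⟨γw, hγw⟩ := exists_localOmega_weylDelta_apply_eq_smul L v μ n₁ hT₁ rfl hTv₁
    (localSplittingDatumCM L v μ n₁ hT₁ hT₁d rfl χ hχ) (MpPsi.proj _ p₁) (MpPsi.toOp _ p₁) (MpPsi.toRep_implements _ p₁) B₁ hW₁ hm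
  refine ⟨γw, fun Φ₁ Φ₂ => ?_⟩
  rw [rep_mul_apply (MpPsi.toRep (localSchrodinger (maximalRealSubfield L) ((n₁ + n₂) + (n₁ + n₂))
      (gramD (maximalRealSubfield L) (n₁ + n₂) (UnitaryGroup.finSum n₁ n₂ T₁ T₂)) v))
      (boxLoc (maximalRealSubfield L) v n₁ n₂ (T₁ := T₁) (T₂ := T₂) (p₁, p₂)) _
      (boxSB (v.adicCompletion (maximalRealSubfield L)) (blkIdx n₁ n₂) Φ₁ Φ₂),
    toRep_localSplitting_blkLoc_boxSB L v μ n₁ n₂ hT₁ hT₂ hT₁d hT₂d χ hχ hn₁ t₁ hT₁t _ Φ₁ Φ₂, hγw Φ₁,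
    boxSB_smul_left (v.adicCompletion (maximalRealSubfield L)) (blkIdx n₁ n₂) (γw : ℂ) _ Φ₂, LinearMap.map_smul,
    toRep_boxLoc_boxSB (maximalRealSubfield L) v n₁ n₂ p₁ p₂ _ Φ₂, hp₁rep, hp₂rep, LinearEquiv.apply_symm_apply]

include hT₁d in
set_option maxHeartbeats 16000000 in -- MEASURED 2026-09-05: 4 000 000 ✗ (`isDefEq` in `hR`, `whnf`); 16 000 000 ✓ — the pure-tensor instance + `linearMap_ext_boxSB` retype the doubled CM telescope
/-- ★ **(W-w₂)@POINT, BLOCK DATUM, OPERATOR FORM.**  For Kudla's CM splitting `s_T` of `U((T₁ ⊕ᶠ T₂)^𝔻)(L⁺_v)` (`T₁ = diagonal t₁`, `0 < n₁`), block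
implementers `p₁ ∈ S̃p_ψ(𝕎^𝔻_{T₁})` Cayley-type (`hW₁ : π(p₁) ι(w_Δ^{T₁}) π(p₁)⁻¹ = J_𝕋⁻¹ m(B₁)`) and `p₂ ∈ S̃p_ψ(𝕎^𝔻_{T₂})` (ANY — not even a mover is needed),
there is ONE unit `γ` with, for EVERY `Ψ ∈ 𝒮(L⁺_v^{(n₁+n₂)+(n₁+n₂)})`,
`op(j̃(p₁,p₂)) (ω(s_T(blkLoc w_Δ^{T₁})) Ψ) = γ • ((𝓕 ∘ leviOpPi B₁) ⊠ 1) (op(j̃(p₁,p₂)) Ψ)` — the middle Weyl element acts, in the `j̃`-model, as the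
PARTIAL FOURIER OPERATOR OF THE FIRST BLOCK (twisted by `leviOpPi B₁`, `|det B₁|^{-1/2} Φ(B₁⁻¹ ·)`): the pure-tensor identity above, and pure tensors span
(★ `linearMap_ext_boxSB`).  Evaluating at `x₁ ⊔ 0` and integrating is ★ F6a∕F6c∕(M2a-C1); evaluating at a GENERAL point `q₁ ⊔ q₂` is what the (σ-A) ζ-stage needs.
[cite: Kudla1984, §1] [cite: Kudla1994, §3 Thm. 3.1] [cite: Weil1964, n° 13 (16), p. 160] [cite: MoeglinVignerasWaldspurger1987, Chap. 2 II.1 Rem. (6), II.6]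
[cite: WeilBNT1967, Chap. VII §2, Prop. 2] -/
theorem exists_toOp_boxLoc_localSplitting_blkLoc_weylDelta_eq_smul_boxEquivSB (hn₁ : 0 < n₁) (t₁ : Fin n₁ → maximalRealSubfield L)
    (hT₁t : T₁ = Matrix.diagonal t₁)
    (hTv₁ : IsUnit (localGram (maximalRealSubfield L) (n₁ + n₁) (gramD (maximalRealSubfield L) n₁ T₁) v).det)
    (p₁ : LocalMp (maximalRealSubfield L) (n₁ + n₁) (gramD (maximalRealSubfield L) n₁ T₁) v)
    (B₁ : GL (Fin (n₁ + n₁)) (v.adicCompletion (maximalRealSubfield L)))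
    (hW₁ : MpPsi.proj _ p₁ * iotaD (maximalRealSubfield L) L (IsCMField.complexConj L) (complexConj_imagUnit L) (imagUnit_ne_zero L)
        (imagUnit_mul_self L) v n₁ hT₁ rfl (weylDelta (maximalRealSubfield L) L (IsCMField.complexConj L) v n₁ (T₀ := T₁) rfl) * (MpPsi.proj _ p₁)⁻¹ =
      (transportSp (localGram (maximalRealSubfield L) (n₁ + n₁) (gramD (maximalRealSubfield L) n₁ T₁) v) hTv₁ (SymplecticGroup.symJ _ _))⁻¹ *
        transportSp (localGram (maximalRealSubfield L) (n₁ + n₁) (gramD (maximalRealSubfield L) n₁ T₁) v) hTv₁ (levi B₁))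
    {m : ℤ} (hm : (adeleAddCharAt (maximalRealSubfield L) v).HasConductorExp m)
    (p₂ : LocalMp (maximalRealSubfield L) (n₂ + n₂) (gramD (maximalRealSubfield L) n₂ T₂) v) :
    ∃ γ : ℂˣ, ∀ Ψ : SchwartzBruhat (Fin ((n₁ + n₂) + (n₁ + n₂)) → v.adicCompletion (maximalRealSubfield L)),
      MpPsi.toOp _ (boxLoc (maximalRealSubfield L) v n₁ n₂ (T₁ := T₁) (T₂ := T₂) (p₁, p₂))
          (MpPsi.toRep (localSchrodinger (maximalRealSubfield L) ((n₁ + n₂) + (n₁ + n₂))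
            (gramD (maximalRealSubfield L) (n₁ + n₂) (UnitaryGroup.finSum n₁ n₂ T₁ T₂)) v)
            ((localSplittingDatumCM L v μ (n₁ + n₂) (UnitaryGroup.isSymm_finSum hT₁ hT₂) (isUnit_det_finSum L n₁ n₂ hT₁d hT₂d) rfl χ hχ).localSplitting
              (blkLoc (maximalRealSubfield L) L (IsCMField.complexConj L) v n₁ n₂ (T₁ := T₁) (T₂ := T₂) rfl rfl
                (weylDelta (maximalRealSubfield L) L (IsCMField.complexConj L) v n₁ (T₀ := T₁) rfl))) Ψ) =
        (γ : ℂ) • boxEquivSB (v.adicCompletion (maximalRealSubfield L)) (blkIdx n₁ n₂)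
          (fourierOpPi μ (isContinuousNontrivial_adeleAddCharAt (maximalRealSubfield L) v) hm * leviOpPi (glEquiv B₁))
          (LinearEquiv.refl ℂ _)
          (MpPsi.toOp _ (boxLoc (maximalRealSubfield L) v n₁ n₂ (T₁ := T₁) (T₂ := T₂) (p₁, p₂)) Ψ) := by
  have hψ := isContinuousNontrivial_adeleAddCharAt (maximalRealSubfield L) v
  obtain ⟨γ, hγ⟩ := exists_toRep_boxLoc_mul_localSplitting_blkLoc_weylDelta_boxSB L v μ n₁ n₂ hT₁ hT₂ hT₁d hT₂d χ hχ hn₁ t₁ hT₁t hTv₁ p₁ B₁ hW₁ hm p₂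
  refine ⟨γ, fun Ψ => ?_⟩
  -- `op(·)` versus `ω(·)` of an element of the metaplectic group of pairs (definitional)
  have hjrep : ∀ X, MpPsi.toOp _ (boxLoc (maximalRealSubfield L) v n₁ n₂ (T₁ := T₁) (T₂ := T₂) (p₁, p₂)) X =
      MpPsi.toRep (localSchrodinger (maximalRealSubfield L) ((n₁ + n₂) + (n₁ + n₂))
        (gramD (maximalRealSubfield L) (n₁ + n₂) (UnitaryGroup.finSum n₁ n₂ T₁ T₂)) v)
        (boxLoc (maximalRealSubfield L) v n₁ n₂ (T₁ := T₁) (T₂ := T₂) (p₁, p₂)) X := fun _ => rfl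
  have hp₁rep : ∀ X, MpPsi.toRep (localSchrodinger (maximalRealSubfield L) (n₁ + n₁) (gramD (maximalRealSubfield L) n₁ T₁) v) p₁ X =
      MpPsi.toOp _ p₁ X := fun _ => rfl
  have hp₂rep : ∀ X, MpPsi.toRep (localSchrodinger (maximalRealSubfield L) (n₂ + n₂) (gramD (maximalRealSubfield L) n₂ T₂) v) p₂ X =
      MpPsi.toOp _ p₂ X := fun _ => rfl
  -- both sides are linear in `Ψ`; compare them on pure tensors (★ `linearMap_ext_boxSB`)
  have key : (MpPsi.toOp _ (boxLoc (maximalRealSubfield L) v n₁ n₂ (T₁ := T₁) (T₂ := T₂) (p₁, p₂))).toLinearMap ∘ₗ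
        (MpPsi.toRep (localSchrodinger (maximalRealSubfield L) ((n₁ + n₂) + (n₁ + n₂))
            (gramD (maximalRealSubfield L) (n₁ + n₂) (UnitaryGroup.finSum n₁ n₂ T₁ T₂)) v)
            ((localSplittingDatumCM L v μ (n₁ + n₂) (UnitaryGroup.isSymm_finSum hT₁ hT₂) (isUnit_det_finSum L n₁ n₂ hT₁d hT₂d) rfl χ hχ).localSplitting
              (blkLoc (maximalRealSubfield L) L (IsCMField.complexConj L) v n₁ n₂ (T₁ := T₁) (T₂ := T₂) rfl rfl
                (weylDelta (maximalRealSubfield L) L (IsCMField.complexConj L) v n₁ (T₀ := T₁) rfl)))) =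
      ((γ : ℂ) • (boxEquivSB (v.adicCompletion (maximalRealSubfield L)) (blkIdx n₁ n₂)
          (fourierOpPi μ hψ hm * leviOpPi (glEquiv B₁))
          (LinearEquiv.refl ℂ (SchwartzBruhat (Fin (n₂ + n₂) → v.adicCompletion (maximalRealSubfield L))))).toLinearMap) ∘ₗ
        (MpPsi.toOp _ (boxLoc (maximalRealSubfield L) v n₁ n₂ (T₁ := T₁) (T₂ := T₂) (p₁, p₂))).toLinearMap := by
    refine linearMap_ext_boxSB (v.adicCompletion (maximalRealSubfield L)) (blkIdx n₁ n₂) fun Φ₁ Φ₂ => ?_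
    simp only [LinearMap.coe_comp, Function.comp_apply, LinearEquiv.coe_coe, LinearMap.smul_apply]
    -- LHS: `op(j̃)(ω(s w₁)(Φ₁ ⊠ Φ₂)) = ω(j̃ · s w₁)(Φ₁ ⊠ Φ₂)` = the pure-tensor identity
    have hL : MpPsi.toOp _ (boxLoc (maximalRealSubfield L) v n₁ n₂ (T₁ := T₁) (T₂ := T₂) (p₁, p₂))
          (MpPsi.toRep (localSchrodinger (maximalRealSubfield L) ((n₁ + n₂) + (n₁ + n₂))
            (gramD (maximalRealSubfield L) (n₁ + n₂) (UnitaryGroup.finSum n₁ n₂ T₁ T₂)) v)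
            ((localSplittingDatumCM L v μ (n₁ + n₂) (UnitaryGroup.isSymm_finSum hT₁ hT₂) (isUnit_det_finSum L n₁ n₂ hT₁d hT₂d) rfl χ hχ).localSplitting
              (blkLoc (maximalRealSubfield L) L (IsCMField.complexConj L) v n₁ n₂ (T₁ := T₁) (T₂ := T₂) rfl rfl
                (weylDelta (maximalRealSubfield L) L (IsCMField.complexConj L) v n₁ (T₀ := T₁) rfl)))
            (boxSB (v.adicCompletion (maximalRealSubfield L)) (blkIdx n₁ n₂) Φ₁ Φ₂)) =
        (γ : ℂ) • boxSB (v.adicCompletion (maximalRealSubfield L)) (blkIdx n₁ n₂)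
          (fourierOpPi μ hψ hm (leviOpPi (glEquiv B₁) (MpPsi.toOp _ p₁ Φ₁))) (MpPsi.toOp _ p₂ Φ₂) := by
      rw [hjrep, ← rep_mul_apply (MpPsi.toRep (localSchrodinger (maximalRealSubfield L) ((n₁ + n₂) + (n₁ + n₂))
          (gramD (maximalRealSubfield L) (n₁ + n₂) (UnitaryGroup.finSum n₁ n₂ T₁ T₂)) v))
          (boxLoc (maximalRealSubfield L) v n₁ n₂ (T₁ := T₁) (T₂ := T₂) (p₁, p₂)) _
          (boxSB (v.adicCompletion (maximalRealSubfield L)) (blkIdx n₁ n₂) Φ₁ Φ₂)]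
      exact hγ Φ₁ Φ₂
    -- RHS: `op(j̃)(Φ₁ ⊠ Φ₂) = op(p₁)Φ₁ ⊠ op(p₂)Φ₂`, then `((𝓕 ∘ L) ⊠ 1)`
    have hR : boxEquivSB (v.adicCompletion (maximalRealSubfield L)) (blkIdx n₁ n₂)
          (fourierOpPi μ hψ hm * leviOpPi (glEquiv B₁))
          (LinearEquiv.refl ℂ (SchwartzBruhat (Fin (n₂ + n₂) → v.adicCompletion (maximalRealSubfield L))))
          (MpPsi.toOp _ (boxLoc (maximalRealSubfield L) v n₁ n₂ (T₁ := T₁) (T₂ := T₂) (p₁, p₂))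
            (boxSB (v.adicCompletion (maximalRealSubfield L)) (blkIdx n₁ n₂) Φ₁ Φ₂)) =
        boxSB (v.adicCompletion (maximalRealSubfield L)) (blkIdx n₁ n₂)
          (fourierOpPi μ hψ hm (leviOpPi (glEquiv B₁) (MpPsi.toOp _ p₁ Φ₁))) (MpPsi.toOp _ p₂ Φ₂) := by
      rw [hjrep, toRep_boxLoc_boxSB (maximalRealSubfield L) v n₁ n₂ p₁ p₂ Φ₁ Φ₂, hp₁rep, hp₂rep, boxEquivSB_boxSB, LinearEquiv.mul_apply,
        LinearEquiv.refl_apply]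
    rw [hL, hR]
  have h := LinearMap.congr_fun key Ψ
  simpa only [LinearMap.coe_comp, Function.comp_apply, LinearEquiv.coe_coe, LinearMap.smul_apply] using h

/-! ## §2 (ED. 2) The y-stage VECTOR word: flip · Siegel element · Siegel unipotent · anything, in the `j̃(p₁, p₂)`-model -/

include hT₁d in
set_option maxHeartbeats 16000000 in -- MEASURED class of §1 (each rewrite retypes the doubled CM telescope; ★ F4a's unipotent word instance is itself 4M-class)
/-- ★ **(W-w₂)@POINT, BLOCK DATUM: THE y-STAGE VECTOR WORD.**  With §1's data, `p₁`, `p₂` over movers (`hp₁`, `hp₂`), a Siegel element `q ∈ P_Δ(L⁺_v)` of the block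
doubled group (`blkC (matA q) = 0`) and any `g`: for ONE unit `γ` (§1's), every skew `t` (with the `q`-conjugate `A t D⁻¹` skew, `hAtD`) and every `Ψ`,
`op(j̃(p₁,p₂)) (ω(s_T(w₁ · q · n(t) · g)) Ψ) = γ • ((𝓕 ∘ leviOpPi B₁) ⊠ 1) (unipOpPi c_{A t D⁻¹} (op(j̃(p₁,p₂)) (ω(s_T(q · g)) Ψ)))`,
`c_{t′} = cOfFix 𝕋 (π(j̃) ι(n(t′)) π(j̃)⁻¹)` — `w₁ · q · n(t) · g = w₁ · n(A t D⁻¹) · (q · g)` (★ `nElem_conj_eq`), `ω ∘ s_T` multiplicative, §1 at the vector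
`ω(s_T(n(A t D⁻¹) · q · g)) Ψ`, and ★ F4a's EXACT unipotent word `op(j̃) (ω(s_T n(t′)) Ξ) = unipOpPi c_{t′} (op(j̃) Ξ)` (`hpar` by ★ `parabolicAtUnipotents_localSplittingDatumCM`,
`j̃` a mover-implementer by ★ F6a `map_deltaLagrangian_proj_boxLoc`).  Integrating `(·)(x₁ ⊔ 0)` over `X₁` is ★ (M2a-C1); reading at `q₁ ⊔ q₂` is the ζ-stage's input.
[cite: Kudla1994, §3 Thm. 3.1] [cite: Rangarao1993, Lemma 3.2 (3.8), p. 351] [cite: MoeglinVignerasWaldspurger1987, Chap. 2 II.1 Rem. (6), II.6] [cite: Weil1964, n° 13 (16), p. 160] -/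
theorem exists_toOp_boxLoc_localSplitting_flip_siegel_nElem_mul_eq_smul_boxEquivSB (hn₁ : 0 < n₁) (t₁ : Fin n₁ → maximalRealSubfield L)
    (hT₁t : T₁ = Matrix.diagonal t₁)
    (hTv₁ : IsUnit (localGram (maximalRealSubfield L) (n₁ + n₁) (gramD (maximalRealSubfield L) n₁ T₁) v).det)
    (p₁ : LocalMp (maximalRealSubfield L) (n₁ + n₁) (gramD (maximalRealSubfield L) n₁ T₁) v)
    (hp₁ : (deltaLagrangian (maximalRealSubfield L) v n₁).map (toLin (maximalRealSubfield L) v (MpPsi.proj _ p₁)) = lagrangianY (maximalRealSubfield L) (n₁ + n₁) v)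
    (B₁ : GL (Fin (n₁ + n₁)) (v.adicCompletion (maximalRealSubfield L)))
    (hW₁ : MpPsi.proj _ p₁ * iotaD (maximalRealSubfield L) L (IsCMField.complexConj L) (complexConj_imagUnit L) (imagUnit_ne_zero L)
        (imagUnit_mul_self L) v n₁ hT₁ rfl (weylDelta (maximalRealSubfield L) L (IsCMField.complexConj L) v n₁ (T₀ := T₁) rfl) * (MpPsi.proj _ p₁)⁻¹ =
      (transportSp (localGram (maximalRealSubfield L) (n₁ + n₁) (gramD (maximalRealSubfield L) n₁ T₁) v) hTv₁ (SymplecticGroup.symJ _ _))⁻¹ *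
        transportSp (localGram (maximalRealSubfield L) (n₁ + n₁) (gramD (maximalRealSubfield L) n₁ T₁) v) hTv₁ (levi B₁))
    {m : ℤ} (hm : (adeleAddCharAt (maximalRealSubfield L) v).HasConductorExp m)
    (p₂ : LocalMp (maximalRealSubfield L) (n₂ + n₂) (gramD (maximalRealSubfield L) n₂ T₂) v)
    (hp₂ : (deltaLagrangian (maximalRealSubfield L) v n₂).map (toLin (maximalRealSubfield L) v (MpPsi.proj _ p₂)) = lagrangianY (maximalRealSubfield L) (n₂ + n₂) v) :
    ∃ γ : ℂˣ, ∀ (t : Matrix (Fin (n₁ + n₂)) (Fin (n₁ + n₂)) (LocalRing L v))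
      (ht : (t.map (conjLocal L (IsCMField.complexConj L) v))ᵀ * gramS (maximalRealSubfield L) L v (n₁ + n₂) (UnitaryGroup.finSum n₁ n₂ T₁ T₂) +
        gramS (maximalRealSubfield L) L v (n₁ + n₂) (UnitaryGroup.finSum n₁ n₂ T₁ T₂) * t = 0)
      (q : UnitaryGroup.localPi L (IsCMField.complexConj L) ((n₁ + n₂) + (n₁ + n₂))
        ((gramD (maximalRealSubfield L) (n₁ + n₂) (UnitaryGroup.finSum n₁ n₂ T₁ T₂)).map (algebraMap (maximalRealSubfield L) L)) v)
      (hqC : blkC (matA (maximalRealSubfield L) L (IsCMField.complexConj L) v (n₁ + n₂) q) = 0)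
      (hAtD : ((blkA (matA (maximalRealSubfield L) L (IsCMField.complexConj L) v (n₁ + n₂) q) * t *
            (blkD (matA (maximalRealSubfield L) L (IsCMField.complexConj L) v (n₁ + n₂) q))⁻¹).map (conjLocal L (IsCMField.complexConj L) v))ᵀ *
          gramS (maximalRealSubfield L) L v (n₁ + n₂) (UnitaryGroup.finSum n₁ n₂ T₁ T₂) +
        gramS (maximalRealSubfield L) L v (n₁ + n₂) (UnitaryGroup.finSum n₁ n₂ T₁ T₂) *
          (blkA (matA (maximalRealSubfield L) L (IsCMField.complexConj L) v (n₁ + n₂) q) * t *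
            (blkD (matA (maximalRealSubfield L) L (IsCMField.complexConj L) v (n₁ + n₂) q))⁻¹) = 0)
      (g : UnitaryGroup.localPi L (IsCMField.complexConj L) ((n₁ + n₂) + (n₁ + n₂))
        ((gramD (maximalRealSubfield L) (n₁ + n₂) (UnitaryGroup.finSum n₁ n₂ T₁ T₂)).map (algebraMap (maximalRealSubfield L) L)) v)
      (Ψ : SchwartzBruhat (Fin ((n₁ + n₂) + (n₁ + n₂)) → v.adicCompletion (maximalRealSubfield L))),
      MpPsi.toOp _ (boxLoc (maximalRealSubfield L) v n₁ n₂ (T₁ := T₁) (T₂ := T₂) (p₁, p₂))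
          (MpPsi.toRep (localSchrodinger (maximalRealSubfield L) ((n₁ + n₂) + (n₁ + n₂))
            (gramD (maximalRealSubfield L) (n₁ + n₂) (UnitaryGroup.finSum n₁ n₂ T₁ T₂)) v)
            ((localSplittingDatumCM L v μ (n₁ + n₂) (UnitaryGroup.isSymm_finSum hT₁ hT₂) (isUnit_det_finSum L n₁ n₂ hT₁d hT₂d) rfl χ hχ).localSplitting
              (blkLoc (maximalRealSubfield L) L (IsCMField.complexConj L) v n₁ n₂ (T₁ := T₁) (T₂ := T₂) rfl rfl
                  (weylDelta (maximalRealSubfield L) L (IsCMField.complexConj L) v n₁ (T₀ := T₁) rfl) * q *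
                nElem (maximalRealSubfield L) L (IsCMField.complexConj L) v (n₁ + n₂) (T₀ := UnitaryGroup.finSum n₁ n₂ T₁ T₂) rfl t ht * g)) Ψ) =
        (γ : ℂ) • boxEquivSB (v.adicCompletion (maximalRealSubfield L)) (blkIdx n₁ n₂)
          (fourierOpPi μ (isContinuousNontrivial_adeleAddCharAt (maximalRealSubfield L) v) hm * leviOpPi (glEquiv B₁))
          (LinearEquiv.refl ℂ _)
          (unipOpPi (isLocallyConstant_of_isContinuousNontrivial (isContinuousNontrivial_adeleAddCharAt (maximalRealSubfield L) v))
            (Matrix.mulVecLin (cOfFix (localGram (maximalRealSubfield L) ((n₁ + n₂) + (n₁ + n₂)) (gramD (maximalRealSubfield L) (n₁ + n₂) (UnitaryGroup.finSum n₁ n₂ T₁ T₂)) v)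
              (MpPsi.proj _ (boxLoc (maximalRealSubfield L) v n₁ n₂ (T₁ := T₁) (T₂ := T₂) (p₁, p₂)) *
                iotaD (maximalRealSubfield L) L (IsCMField.complexConj L) (complexConj_imagUnit L) (imagUnit_ne_zero L) (imagUnit_mul_self L) v
                  (n₁ + n₂) (UnitaryGroup.isSymm_finSum hT₁ hT₂) rfl
                  (nElem (maximalRealSubfield L) L (IsCMField.complexConj L) v (n₁ + n₂) (T₀ := UnitaryGroup.finSum n₁ n₂ T₁ T₂) rfl
                    (blkA (matA (maximalRealSubfield L) L (IsCMField.complexConj L) v (n₁ + n₂) q) * t *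
                      (blkD (matA (maximalRealSubfield L) L (IsCMField.complexConj L) v (n₁ + n₂) q))⁻¹) hAtD) *
                (MpPsi.proj _ (boxLoc (maximalRealSubfield L) v n₁ n₂ (T₁ := T₁) (T₂ := T₂) (p₁, p₂)))⁻¹)))
            (MpPsi.toOp _ (boxLoc (maximalRealSubfield L) v n₁ n₂ (T₁ := T₁) (T₂ := T₂) (p₁, p₂))
              (MpPsi.toRep (localSchrodinger (maximalRealSubfield L) ((n₁ + n₂) + (n₁ + n₂))
                (gramD (maximalRealSubfield L) (n₁ + n₂) (UnitaryGroup.finSum n₁ n₂ T₁ T₂)) v)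
                ((localSplittingDatumCM L v μ (n₁ + n₂) (UnitaryGroup.isSymm_finSum hT₁ hT₂) (isUnit_det_finSum L n₁ n₂ hT₁d hT₂d) rfl χ hχ).localSplitting
                  (q * g)) Ψ))) := by
  obtain ⟨γ, hγ⟩ := exists_toOp_boxLoc_localSplitting_blkLoc_weylDelta_eq_smul_boxEquivSB L v μ n₁ n₂ hT₁ hT₂ hT₁d hT₂d χ hχ hn₁ t₁ hT₁t hTv₁
    p₁ B₁ hW₁ hm p₂
  refine ⟨γ, fun t ht q hqC hAtD g Ψ => ?_⟩
  have hP := map_deltaLagrangian_proj_boxLoc L v n₁ n₂ p₁ p₂ hp₁ hp₂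
  -- (1) the Siegel element moves through the unipotent: `w₁ · q · n(t) · g = w₁ · n(A t D⁻¹) · (q · g)`
  have hconj := nElem_conj_eq (maximalRealSubfield L) L (IsCMField.complexConj L) v (n₁ + n₂)
    (JD := (gramD (maximalRealSubfield L) (n₁ + n₂) (UnitaryGroup.finSum n₁ n₂ T₁ T₂)).map (algebraMap (maximalRealSubfield L) L)) rfl hqC ht hAtD
  have hsplit : blkLoc (maximalRealSubfield L) L (IsCMField.complexConj L) v n₁ n₂ (T₁ := T₁) (T₂ := T₂) rfl rfl
        (weylDelta (maximalRealSubfield L) L (IsCMField.complexConj L) v n₁ (T₀ := T₁) rfl) * q *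
        nElem (maximalRealSubfield L) L (IsCMField.complexConj L) v (n₁ + n₂) (T₀ := UnitaryGroup.finSum n₁ n₂ T₁ T₂) rfl t ht * g =
      blkLoc (maximalRealSubfield L) L (IsCMField.complexConj L) v n₁ n₂ (T₁ := T₁) (T₂ := T₂) rfl rfl
          (weylDelta (maximalRealSubfield L) L (IsCMField.complexConj L) v n₁ (T₀ := T₁) rfl) *
        (nElem (maximalRealSubfield L) L (IsCMField.complexConj L) v (n₁ + n₂) (T₀ := UnitaryGroup.finSum n₁ n₂ T₁ T₂) rfl
          (blkA (matA (maximalRealSubfield L) L (IsCMField.complexConj L) v (n₁ + n₂) q) * t *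
            (blkD (matA (maximalRealSubfield L) L (IsCMField.complexConj L) v (n₁ + n₂) q))⁻¹) hAtD * (q * g)) := by
    rw [hconj]
    simp only [mul_assoc, inv_mul_cancel_left]
  -- (2) ★ F4a's exact unipotent word through `(π(j̃), op(j̃))`
  have hword := implementer_localOmega_nElem_apply L v μ (n₁ + n₂) (UnitaryGroup.isSymm_finSum hT₁ hT₂) (isUnit_det_finSum L n₁ n₂ hT₁d hT₂d) rfl
    (localSplittingDatumCM L v μ (n₁ + n₂) (UnitaryGroup.isSymm_finSum hT₁ hT₂) (isUnit_det_finSum L n₁ n₂ hT₁d hT₂d) rfl χ hχ)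
    (MpPsi.proj _ (boxLoc (maximalRealSubfield L) v n₁ n₂ (T₁ := T₁) (T₂ := T₂) (p₁, p₂))) hP
    (MpPsi.toOp _ (boxLoc (maximalRealSubfield L) v n₁ n₂ (T₁ := T₁) (T₂ := T₂) (p₁, p₂))) (MpPsi.toRep_implements _ _) _ hAtD
    (parabolicAtUnipotents_localSplittingDatumCM L v μ (n₁ + n₂) (UnitaryGroup.isSymm_finSum hT₁ hT₂) (isUnit_det_finSum L n₁ n₂ hT₁d hT₂d) rfl χ hχ
      (MpPsi.proj _ (boxLoc (maximalRealSubfield L) v n₁ n₂ (T₁ := T₁) (T₂ := T₂) (p₁, p₂))) hP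
      (MpPsi.toOp _ (boxLoc (maximalRealSubfield L) v n₁ n₂ (T₁ := T₁) (T₂ := T₂) (p₁, p₂))) (MpPsi.toRep_implements _ _) _ hAtD)
    (MpPsi.toRep (localSchrodinger (maximalRealSubfield L) ((n₁ + n₂) + (n₁ + n₂))
      (gramD (maximalRealSubfield L) (n₁ + n₂) (UnitaryGroup.finSum n₁ n₂ T₁ T₂)) v)
      ((localSplittingDatumCM L v μ (n₁ + n₂) (UnitaryGroup.isSymm_finSum hT₁ hT₂) (isUnit_det_finSum L n₁ n₂ hT₁d hT₂d) rfl χ hχ).localSplitting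
        (q * g)) Ψ)
  -- (3) `ω ∘ s_T` is multiplicative: `ω(s(w₁ · (n′ · x))) Ψ = ω(s w₁) (ω(s n′) (ω(s x) Ψ))`
  rw [hsplit, map_mul, map_mul, Module.End.mul_apply, map_mul, map_mul, Module.End.mul_apply, hγ]
  -- (4) the unipotent word on the inner vector (`ω(s n′) Ξ = Σ.localOmega n′ Ξ` definitionally; `congr` closes with `hword`)
  congr 2

end Summit.HodgeConjecture.HodgeConjecture.Cruxes.HLiu418.K2LiuLocalSWCornerVectorAtPoint

end
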